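import Summits.RiemannHypothesis.RiemannHypothesis.Theses.SignCone
import Literature.NumberTheory.LFunctions.WeilExplicit
import Literature.NumberTheory.LFunctions.WeilMarkovQuadratic
import Literature.NumberTheory.LFunctions.WeilArchimedeanPositivityProofs
import Literature.Analysis.SpecialFunctions.EulerMascheroniBounds
import Summits.RiemannHypothesis.RiemannHypothesis.Theorems.SignConeSignConeFarFieldStubBombieriReal
import Summits.RiemannHypothesis.RiemannHypothesis.Theorems.SignConeSignConeFarFieldStubRegionOneTwo
import Summits.RiemannHypothesis.RiemannHypothesis.Theorems.SignConeSignConeFarFieldStubRegionThreeFour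
import Summits.RiemannHypothesis.RiemannHypothesis.Theorems.SignConeSignConeFarFieldStubIntThree
import Summits.RiemannHypothesis.RiemannHypothesis.Theorems.SignConeSignConeFarFieldStubIntFour
import Summits.RiemannHypothesis.RiemannHypothesis.Theorems.SignConeSignConeFarFieldStubNumerics
import Summits.RiemannHypothesis.RiemannHypothesis.Theorems.SignConeSignConeFarFieldStubSplit

/-!
# `SignCone.SignConeFarField` — line `Sketch` (plastic-weight bookkeeping)
(item stmt-RiemannHypothesis-16305, route route-RiemannHypothesis-SignCone)

THE CRUX (support #9 of route SignCone, unconditional): for every cutoff `a > 0` and every finite family of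
Weil tests `gᵢ` supported in `[-a, a]` whose autocorrelation sum `F = Σᵢ gᵢ ⋆ g̃ᵢ` is non-negative at the
nodes `log n` and has `Re F(t) ≥ 0` for all `|t| ≥ log 2` (far-field class), the archimedean-plus-polar part
of Weil's functional satisfies `Re W_ar(F) ≥ -Re F(0)`, `W_ar = weilPolarTerm + weilArchTerm`.

LINE (idea card `Cruxes/SignConeFarField/Ideas/plastic-weight-bookkeeping.md`): write `W_ar(F)` in
Bombieri's form as ONE absolutely convergent real integral over `(0, ∞)`,
`Re W_ar(F) = ∫₀^∞ h(x) dx − (log 4π + γ)·A`, `A = Re F(0)`, `s(x) = Re F(x) + Re F(−x)`,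
`h(x) = s(x)(e^{-x/2} + e^{x/2}) − (e^{x/2} s(x) − 2A)/(2 sinh x) = s(x)·w(x) + A/sinh x`
with Bombieri's weight `w(x) = e^{-x/2} + e^{x/2} − e^{x/2}/(2 sinh x)` (`w ≤ 0` iff `e^{3x} ≤ e^x + 1`,
i.e. `x ≤ t_w = log(plastic number) = 0.28120`). Positive-definiteness enters only through `|s| ≤ 2A`
(all `x`) and the far-field sign `s ≥ 0` (`x ≥ log 2`). Pointwise minorants `h ≥ A·φ` on the five pieces
`(0, t₁]`, `[t₁, t₂]`, `[t₂, log 2]`, `[log 2, log 2001]`, `[log 2001, ∞)` with the RATIONAL-friendly split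
points `t₁ = 4 log(15/14) = 0.27597 < t_w < t₂ = 2 log(7/6) = 0.30830` (every `sinh`, `cosh`, `e^{x/2}` at a
split point is rational): `φ = 97/28`, `2.79`, `u/(u−1) − (36/85)u(u−1) − 2u − 2/u` (`u = e^{x/2}`; the
arctan-free minorant of `1/sinh − 2w`, exact primitive `2 log(u−1) − (36/85)(u−1)² − 4u + 4/u`), `1/sinh x`
(primitive `log tanh(x/2)`), `0`. Integrals: `≥ 0.95604 + 0.09020 + 4/25 + (log 3 − 1/1000) = 2.3039`
against `log 4π + γ − 1 = 2.1082` (margin `0.196`; with Mathlib-only crude constants `0.093`).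

Dictionary (verbatim expansions, no local `def`):
* `A`            ↦ `(F 0).re`;  `s x` ↦ `(F x).re + (F (-x)).re`
* `h A σ x`      ↦ `σ * (Real.exp (-(x / 2)) + Real.exp (x / 2)) - (Real.exp (x / 2) * σ - 2 * A) / (2 * Real.sinh x)`
* `φ₃ x`         ↦ `Real.exp (x / 2) / (Real.exp (x / 2) - 1) - 36 / 85 * (Real.exp (x / 2) * (Real.exp (x / 2) - 1))
                     - 2 * Real.exp (x / 2) - 2 * Real.exp (-(x / 2))`
* `t₁, t₂, T`    ↦ `4 * Real.log (15 / 14)`, `2 * Real.log (7 / 6)`, `Real.log 2001`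

Stubs (registered `stub_*`, each LANDED in its own `Theorems/SignConeSignConeFarFieldStub*.lean` file,
imported above): `stub_bombieriReal` (Bombieri form, real part, one integral), `stub_regionOneTwo`,
`stub_regionThreeFour` (pointwise minorants), `stub_intThree`, `stub_intFour` (closed-form integrals),
`stub_numerics` (the constant inequality), `stub_split` (measure-theoretic splitting of `∫_{(0,∞)} h`).
This file is the sorry-free composition: `farFieldMajorant` (single `F`), `farFieldMajorant_sum`
(`F = Σᵢ gᵢ ⋆ g̃ᵢ`, Bombieri's Lemma 2 gives `|Re F| ≤ Re F(0)`) and `SignConeFarField_of` (the crux BY NAME).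
-/

noncomputable section

-- `Summit.RiemannHypothesis.RiemannHypothesis.…` repeats a namespace component by design (D-0017 layout).
set_option linter.dupNamespace false

open scoped BigOperators ComplexConjugate
open Complex MeasureTheory Set Filter

namespace Summit.RiemannHypothesis.RiemannHypothesis.Theorems.SignConeFarField

open Literature.NumberTheory.LFunctions

/-! ### The composition -/

/-- **The far-field majorant** (analytic core, single function): for a Weil test `F` with
`|Re F(t)| ≤ Re F(0)` everywhere and `Re F(t) ≥ 0` for `|t| ≥ log 2`,
`-Re F(0) ≤ Re (weilPolarTerm F + weilArchTerm F)` — in fact `≥ (2.3039 − log 4π − γ)·Re F(0)`.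
Positive-definiteness, the cutoff, the index set and the node hypothesis of the crux are not needed. -/
theorem farFieldMajorant (F : ℝ → ℂ) (hF : IsWeilTest F) (hbd : ∀ t : ℝ, |(F t).re| ≤ (F 0).re)
    (hfar : ∀ t : ℝ, Real.log 2 ≤ |t| → 0 ≤ (F t).re) :
    -(F 0).re ≤ (weilPolarTerm F + weilArchTerm F).re := by
  obtain ⟨hint, hform⟩ := stub_bombieriReal F hF
  set A : ℝ := (F 0).re with hA_def
  set h : ℝ → ℝ := fun x : ℝ => ((F x).re + (F (-x)).re) * (Real.exp (-(x / 2)) + Real.exp (x / 2)) -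
    (Real.exp (x / 2) * ((F x).re + (F (-x)).re) - 2 * A) / (2 * Real.sinh x) with hh_def
  have hA : 0 ≤ A := le_trans (abs_nonneg _) (hbd 0)
  have hs_le : ∀ x : ℝ, (F x).re + (F (-x)).re ≤ 2 * A := fun x => by
    have h1 := (abs_le.1 (hbd x)).2
    have h2 := (abs_le.1 (hbd (-x))).2
    linarith
  have hs_ge : ∀ x : ℝ, -(2 * A) ≤ (F x).re + (F (-x)).re := fun x => by
    have h1 := (abs_le.1 (hbd x)).1
    have h2 := (abs_le.1 (hbd (-x))).1
    linarith
  have hs_abs : ∀ x : ℝ, |(F x).re + (F (-x)).re| ≤ 2 * A := fun x =>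
    abs_le.2 ⟨hs_ge x, hs_le x⟩
  have hs_far : ∀ x : ℝ, Real.log 2 ≤ x → 0 ≤ (F x).re + (F (-x)).re := fun x hx => by
    have hx0 : 0 ≤ x := le_trans (Real.log_nonneg one_le_two) hx
    have h1 := hfar x (by rwa [abs_of_nonneg hx0])
    have h2 := hfar (-x) (by rwa [abs_neg, abs_of_nonneg hx0])
    linarith
  have h1 : ∀ x, 0 < x → x ≤ 4 * Real.log (15 / 14) → A * (97 / 28) ≤ h x :=
    fun x hx hx1 => stub_regionOneTwo.1 A _ x hA (hs_le x) hx hx1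
  have h2 : ∀ x, 4 * Real.log (15 / 14) ≤ x → x ≤ 2 * Real.log (7 / 6) → A * (279 / 100) ≤ h x :=
    fun x hx hx1 => stub_regionOneTwo.2 A _ x hA (hs_abs x) hx hx1
  have h3 : ∀ x, 2 * Real.log (7 / 6) ≤ x →
      A * (Real.exp (x / 2) / (Real.exp (x / 2) - 1) - 36 / 85 * (Real.exp (x / 2) * (Real.exp (x / 2) - 1)) -
        2 * Real.exp (x / 2) - 2 * Real.exp (-(x / 2))) ≤ h x :=
    fun x hx => stub_regionThreeFour.1 A _ x hA (hs_ge x) hx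
  have h4 : ∀ x, Real.log 2 ≤ x → A / Real.sinh x ≤ h x :=
    fun x hx => stub_regionThreeFour.2 A _ x hA (hs_far x hx) hx
  have hsplit := stub_split A h hA hint h1 h2 h3 h4
  have hI3 := stub_intThree
  have hI4 := stub_intFour
  have hnum := stub_numerics
  have key : (Real.log (4 * Real.pi) + Real.eulerMascheroniConstant - 1) * A ≤ ∫ x in Set.Ioi (0 : ℝ), h x := by
    refine le_trans ?_ hsplit
    rw [mul_comm]
    exact mul_le_mul_of_nonneg_left (by linarith) hA
  rw [hform]
  linarith

/-- Finite sums of Weil tests are Weil tests. -/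
theorem isWeilTest_sum {ι : Type*} (s : Finset ι) {G : ι → ℝ → ℂ} (hG : ∀ i ∈ s, IsWeilTest (G i)) :
    IsWeilTest (fun t => ∑ i ∈ s, G i t) := by
  classical
  induction s using Finset.induction_on with
  | empty =>
    simp only [Finset.sum_empty]
    exact ⟨contDiff_const, HasCompactSupport.zero⟩
  | insert a s ha ih =>
    have h1 : IsWeilTest (G a) := hG a (Finset.mem_insert_self a s)
    have h2 : IsWeilTest (fun t => ∑ i ∈ s, G i t) := ih fun i hi => hG i (Finset.mem_insert_of_mem hi)
    have e : (fun t => ∑ i ∈ insert a s, G i t) = fun t => G a t + ∑ i ∈ s, G i t := by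
      funext t
      rw [Finset.sum_insert ha]
    rw [e]
    exact h1.add h2

/-- **The far-field majorant for autocorrelation sums**: for Weil tests `gᵢ` and `F = Σᵢ gᵢ ⋆ g̃ᵢ` with
`Re F(t) ≥ 0` for `|t| ≥ log 2`, `-Re F(0) ≤ Re (weilPolarTerm F + weilArchTerm F)`; the bound
`|Re F(t)| ≤ ‖F(t)‖ ≤ Σᵢ ‖gᵢ‖₂² = Re F(0)` is Bombieri's Lemma 2 (`norm_weilConv_weilReflect_le`) summed over `i`. -/
theorem farFieldMajorant_sum {k : ℕ} {g : Fin k → ℝ → ℂ} {F : ℝ → ℂ}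
    (hFdef : F = fun t => ∑ i, weilConv (g i) (weilReflect (g i)) t) (hg : ∀ i, IsWeilTest (g i))
    (hfar : ∀ t : ℝ, Real.log 2 ≤ |t| → 0 ≤ (F t).re) :
    -(F 0).re ≤ (weilPolarTerm F + weilArchTerm F).re := by
  have hGi : ∀ i, IsWeilTest (weilConv (g i) (weilReflect (g i))) := fun i =>
    (hg i).weilConv (hg i).weilReflect
  have hFt : IsWeilTest F := by
    rw [hFdef]
    exact isWeilTest_sum _ fun i _ => hGi i
  have h0 : (F 0).re = ∑ i, ∫ t, ‖g i t‖ ^ 2 := by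
    rw [hFdef]
    simp only [Complex.re_sum, weilConv_weilReflect_apply_zero, Complex.ofReal_re]
  have hbd : ∀ t : ℝ, |(F t).re| ≤ (F 0).re := fun t => by
    calc |(F t).re| ≤ ‖F t‖ := Complex.abs_re_le_norm _
      _ = ‖∑ i, weilConv (g i) (weilReflect (g i)) t‖ := by rw [hFdef]
      _ ≤ ∑ i, ‖weilConv (g i) (weilReflect (g i)) t‖ := norm_sum_le _ _
      _ ≤ ∑ i, ∫ u, ‖g i u‖ ^ 2 := Finset.sum_le_sum fun i _ => norm_weilConv_weilReflect_le (hg i) t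
      _ = (F 0).re := h0.symm
  exact farFieldMajorant F hFt hbd hfar

/-- **THE CRUX — `SignCone.SignConeFarField`** (concluded BY NAME): the item's `M`-form is definitionally
`-(F 0).re ≤ (weilPolarTerm F + weilArchTerm F).re` for `F = Σᵢ gᵢ ⋆ g̃ᵢ` (route CONE NOTE, rev 3), so
`farFieldMajorant_sum` closes it; the cutoff `a`, the supports and the node hypothesis are not used. -/
theorem SignConeFarField_of :
    Summit.RiemannHypothesis.RiemannHypothesis.Theses.SignCone.SignConeFarField := by
  intro a _ha k g hg F _hn hff M
  have hgi : ∀ i, IsWeilTest (g i) := fun i => (hg i).1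
  exact farFieldMajorant_sum (g := g) (F := F) rfl hgi hff

end Summit.RiemannHypothesis.RiemannHypothesis.Theorems.SignConeFarField

end
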